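import Mathlib
import HarnessLib
import Summits.Langlands.Langlands.Theorems.SplitPrimeDescentLadderResidual
import Literature.NumberTheory.GaloisRepresentations.AbsGaloisGroupProofs

set_option linter.dupNamespace false

/-!
# E∞' `ShapePreservingResidualEngine` — stub S3 `stub_identityShape` PROVED (lens-1 g35)

The identity-shape rung of the engine skeleton `g34/v3/birth_ShapePreservingResidualEngine.lean`
(critic row 467: "S3 is the plan-only rung (first target)") is closed here with `M' := M`,
`Algebra.id M`: the restriction `τ₃|_{Γ_{M'}} = τ₃ ∘ absGaloisRestrict M M` along the identity is a
CHANGE OF FRAME `g ↦ P τ₃(g) P⁻¹` (`absGaloisRestrict_isConj_of_algHom_holds` with `ι' = id`: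
`absGaloisRestrict M M = γ⁻¹ (·) γ` for a fixed `γ ∈ Γ_M`, so `τ₃|_{M} = FramedRep.conj (τ₃ γ)⁻¹ τ₃`), and
finiteness of the image, the projective image and `TameLevel.IsPadicallyAutomorphic`
(`= ∃ x, Continuous x ∧ ∀ v ∉ bad, IsUnramifiedAt ∧ HasFrobCharpolyAt`) are invariant under change of frame
(`FramedGaloisRep.isUnramifiedAt_conj_iff`, `Matrix.charpoly_units_conj`).  0 sorry.
-/

namespace Summit.Langlands.Langlands.Theorems.SplitPrimeDescentLadder.V3Birth.ShapePreservingResidualEngine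

open scoped MatrixGroups
open NumberField IsDedekindDomain
open Literature.NumberTheory.GaloisRepresentations Literature.NumberTheory.Automorphic

/-- Characteristic polynomials of Frobenius are invariant under change of frame (local copy of the
`private` `hasFrobCharpolyAt_conj_iff_aux` of `ResidualPairProofs`; Serre 1968 Ch. I §2.3). [folklore] -/
theorem hasFrobCharpolyAt_conj_iff' {K : Type*} [Field K] [NumberField K] {A : Type*} [CommRing A]
    [TopologicalSpace A] [IsTopologicalRing A] {n : ℕ} (v : HeightOneSpectrum (𝓞 K)) (Q : Polynomial A)
    (g : GL (Fin n) A) (r : FramedGaloisRep K A n) :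
    FramedGaloisRep.HasFrobCharpolyAt v Q (FramedRep.conj g r) ↔ r.HasFrobCharpolyAt v Q := by
  refine forall₂_congr fun 𝔓 _ => forall₂_congr fun s _ => ?_
  have h : FramedRep.charpoly (FramedRep.conj g r) s = FramedRep.charpoly r s := by
    unfold FramedRep.charpoly
    rw [FramedRep.conj_apply, Units.val_mul, Units.val_mul, Matrix.coe_units_inv,
      Matrix.charpoly_units_conj]
  rw [h]

/-- **Restriction along the identity is a change of frame**: for a number field `M` and the identity
algebra structure `M → M`, `ρ|_{Γ_M} := ρ ∘ absGaloisRestrict M M = P ρ P⁻¹` for some `P ∈ GL_n(A)`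
(namely `P = ρ(γ)⁻¹` with `absGaloisRestrict M M = γ⁻¹ (·) γ`, `absGaloisRestrict_isConj_of_algHom_holds`). -/
theorem restrictField_self_eq_conj {M : Type} [Field M] [NumberField M] {A : Type*} [CommRing A]
    [TopologicalSpace A] [IsTopologicalRing A] {n : ℕ} (ρ : FramedGaloisRep M A n) :
    ∃ (γ : Field.absoluteGaloisGroup M), (∀ σ : Field.absoluteGaloisGroup M,
        absGaloisRestrict M M σ = γ⁻¹ * σ * γ) ∧
      FramedGaloisRep.restrictField M ρ = FramedRep.conj (ρ γ)⁻¹ ρ := by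
  obtain ⟨γ, hγ⟩ := absGaloisRestrict_isConj_of_algHom_holds M M (AlgHom.id M (AlgebraicClosure M)) id
    (fun _ _ => rfl)
  have hres : ∀ σ : Field.absoluteGaloisGroup M, absGaloisRestrict M M σ = γ⁻¹ * σ * γ := by
    intro σ
    have h := hγ σ
    calc absGaloisRestrict M M σ = γ⁻¹ * (γ * absGaloisRestrict M M σ * γ⁻¹) * γ := by group
      _ = γ⁻¹ * σ * γ := by rw [← h]; rfl
  refine ⟨γ, hres, ContinuousMonoidHom.ext fun σ => ?_⟩
  rw [FramedGaloisRep.restrictField_apply, FramedRep.conj_apply, hres, map_mul, map_mul, map_inv, inv_inv]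

/-- **S3 `stub_identityShape` — PROVED** (same statement as the registered stub, verbatim). -/
theorem identityShape_holds :
    ∀ (M : Type) [Field M] [NumberField M] (p : IsDedekindDomain.HeightOneSpectrum (NumberField.RingOfIntegers ℚ)), NumberField.IsCMField M → IsGalois ℚ M → IsCyclic (M ≃ₐ[ℚ] M) → Squarefree (Module.finrank ℚ M) → (∀ ℓ : ℕ, ℓ.Prime → ℓ ∣ Module.finrank ℚ M → ℓ = 2 ∨ (2 ^ Ideal.absNorm p.asIdeal ≤ ℓ ∧ ℓ < 2 ^ (Ideal.absNorm p.asIdeal + 1))) → (∀ w : IsDedekindDomain.HeightOneSpectrum (NumberField.RingOfIntegers M), w.asIdeal.under (NumberField.RingOfIntegers ℚ) = p.asIdeal → w.asIdeal.inertiaDeg (NumberField.RingOfIntegers ℚ) = 1 ∧ w.asIdeal.ramificationIdx (NumberField.RingOfIntegers ℚ) = 1) → (∃ (d : ℕ) (z : M), d % 3 = 2 ∧ z ^ 2 + (d : M) = 0) → (∀ z : M, z ^ 2 + z + 1 ≠ 0) → ∀ τ₃ : Literature.NumberTheory.GaloisRepresentations.FramedGaloisRep M (PadicAlgCl 3) 2,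 Finite τ₃.toMonoidHom.range → (∀ w : IsDedekindDomain.HeightOneSpectrum (NumberField.RingOfIntegers M), w.asIdeal.under (NumberField.RingOfIntegers ℚ) = p.asIdeal → τ₃.IsUnramifiedAt w) → Nonempty ((Matrix.ProjGenLinGroup.mk.comp τ₃.toMonoidHom).range ≃* alternatingGroup (Fin 5)) → (∃ 𝒰 : Literature.NumberTheory.Automorphic.BigHeckeGLn.TameLevel 2 M 3, (∀ w : IsDedekindDomain.HeightOneSpectrum (NumberField.RingOfIntegers M), w.asIdeal.under (NumberField.RingOfIntegers ℚ) = p.asIdeal → w ∉ 𝒰.bad) ∧ 𝒰.IsPadicallyAutomorphic τ₃) → ∃ (M' : Type) (_ : Field M') (_ : NumberField M') (_ : Algebra M M'), NumberField.IsCMField M' ∧ IsGalois ℚ M' ∧ IsCyclic (M' ≃ₐ[ℚ] M') ∧ Squarefree (Module.finrank ℚ M') ∧ (∀ ℓ : ℕ, ℓ.Prime → ℓ ∣ Module.finrank ℚ M' → ℓ = 2 ∨ (2 ^ Ideal.absNorm p.asIdeal ≤ ℓ ∧ ℓ < 2 ^ (Ideal.absNorm p.asIdeal + 1))) ∧ (∀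 w : IsDedekindDomain.HeightOneSpectrum (NumberField.RingOfIntegers M'), w.asIdeal.under (NumberField.RingOfIntegers ℚ) = p.asIdeal → w.asIdeal.inertiaDeg (NumberField.RingOfIntegers ℚ) = 1 ∧ w.asIdeal.ramificationIdx (NumberField.RingOfIntegers ℚ) = 1) ∧ Finite (Literature.NumberTheory.GaloisRepresentations.FramedGaloisRep.restrictField M' τ₃).toMonoidHom.range ∧ Nonempty ((Matrix.ProjGenLinGroup.mk.comp (Literature.NumberTheory.GaloisRepresentations.FramedGaloisRep.restrictField M' τ₃).toMonoidHom).range ≃* alternatingGroup (Fin 5)) ∧ ∃ 𝒰 : Literature.NumberTheory.Automorphic.BigHeckeGLn.TameLevel 2 M' 3, (∀ w : IsDedekindDomain.HeightOneSpectrum (NumberField.RingOfIntegers M'), w.asIdeal.under (NumberField.RingOfIntegers ℚ) = p.asIdeal → w ∉ 𝒰.bad) ∧ 𝒰.IsPadicallyAutomorphic (Literature.NumberTheory.GaloisRepresentations.FramedGaloisRep.restrictField M' τ₃) := by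
  intro M _ _ p f1 f2 f3 f4 f5 f6 f7 f8 τ₃ hfin hunr hico hU
  obtain ⟨𝒰, hbad, x, hxc, hassoc⟩ := hU
  obtain ⟨γ, hres, hconj⟩ := restrictField_self_eq_conj τ₃
  have hle : (FramedGaloisRep.restrictField M τ₃).toMonoidHom.range ≤ τ₃.toMonoidHom.range := by
    rintro _ ⟨σ, rfl⟩
    exact ⟨absGaloisRestrict M M σ, rfl⟩
  have hrange : (Matrix.ProjGenLinGroup.mk.comp (FramedGaloisRep.restrictField M τ₃).toMonoidHom).range =
      (Matrix.ProjGenLinGroup.mk.comp τ₃.toMonoidHom).range := by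
    apply le_antisymm
    · rintro _ ⟨σ, rfl⟩
      exact ⟨absGaloisRestrict M M σ, rfl⟩
    · rintro _ ⟨σ, rfl⟩
      refine ⟨γ * σ * γ⁻¹, ?_⟩
      simp only [MonoidHom.comp_apply]
      congr 1
      show τ₃ (absGaloisRestrict M M (γ * σ * γ⁻¹)) = τ₃ σ
      rw [hres]
      congr 1
      group
  refine ⟨M, inferInstance, inferInstance, Algebra.id M, f1, f2, f3, f4, f5, f6,
    Finite.of_injective _ (Subgroup.inclusion_injective hle), ?_, 𝒰, hbad, x, hxc, ?_⟩
  · obtain ⟨e⟩ := hico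
    exact ⟨(MulEquiv.subgroupCongr hrange).trans e⟩
  · intro v hv
    obtain ⟨h1, h2⟩ := hassoc v hv
    refine ⟨?_, ?_⟩
    · rw [hconj]
      exact (FramedGaloisRep.isUnramifiedAt_conj_iff v _ τ₃).2 h1
    · rw [hconj]
      exact (hasFrobCharpolyAt_conj_iff' v _ _ τ₃).2 h2

end Summit.Langlands.Langlands.Theorems.SplitPrimeDescentLadder.V3Birth.ShapePreservingResidualEngine
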